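import Summits.QuantumFields.YangMills.Theorems.BalabanUVNodesPortS1FEInduction

/-!
# BalabanUVNodes — port (S1): `PortRecordFEHalfBox F → FEStepBox F` (the old `stub_FE` statement IMPLIES the v3.6 stub `stub_FEstep` by first-order logic) and the EQUIVALENCE modulo the LZ half
  (◆ CRIT-1 g39 l.5933∕FINAL «S BRICK to land»: the converse of ✓`portRecordFEHalfBox_of_lzHalf_step` — certified on ◆'s and ✦'s desks, not in the tree until now; porter hand `hand-27930-FE-1` g0)

`--supports stmt-QuantumFields-27930` (helper; NO `--workitem`); count-neutral.  [I] = [Balaban1987RG1].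

WHAT THIS FILE IS (proofs only).  ★ `feStepBox_of_feHalfBox : PortRecordFEHalfBox F → FEStepBox F` — take FE's own constants from the box text, ignore the LZ package and the inductive hypothesis
(the named WHY-EASIER of the v3.6 re-point, ★★★ №613 (1)); `stubFEstep_of_stubFE : (∀ F, PortRecordFEHalfBox F) → ∀ F, FEStepBox F`; ★ `feHalfBox_iff_feStepBox_of_lzHalf :
(∀ F, PortRecordLZHalf F) → ((∀ F, PortRecordFEHalfBox F) ↔ (∀ F, FEStepBox F))` — the step letter is NEITHER WEAKER NOR STRONGER than the box text modulo the LZ half the skeleton needs anyway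
(◆'s «SAME-WALL» verdict, in kernel).  DEDUP: 3 new names, 0 tree hits.

HONEST STATUS.  First-order bookkeeping; NOTHING of Bałaban asserted, ported or discharged; `FEStepBox` ∕ `PortRecordFEHalfBox` inhabited NOWHERE; `stub_FEstep` ∕ `stub_P0C` OPEN; ⟨27930⟩ OPEN (1∕3);
NODE O 0∕1; COUNT 8∕28 · K 1∕4 UNMOVED; finite 𝕋⁴_{L^K} at fixed ε — NOT continuum ∕ OS ∕ Clay; **the Yang–Mills mass gap (Clay) is NOT proved by any of this.**  No `sorry`; standard axioms.

References: T. Bałaban, *Renormalization group approach to lattice gauge field theories. I*, Comm. Math. Phys. 109 (1987) 249–301 [Balaban1987RG1] — Thm 3 p.264, p.268 L27–31.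
-/

noncomputable section

namespace Summit.QuantumFields.YangMills.Theorems.BalabanUVNodesPortS1

open Summit.QuantumFields.YangMills.Theorems.K0RecordFormatNames
open Literature.MathematicalPhysics.QuantumFieldTheory.Balaban1983to89
open Literature.MathematicalPhysics.QuantumFieldTheory.Balaban1983to89.T4Continuum (T4Family)

/-- ★ **The box text of the FE half IMPLIES the inductive-step letter** (first-order logic: FE's constants from the box text, the LZ package and the inductive hypothesis unread).
[cite: Balaban1987RG1, Thm 3 p.264 (bookkeeping)] -/
theorem feStepBox_of_feHalfBox {F : T4Family} (h : PortRecordFEHalfBox F) : FEStepBox F := by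
  obtain ⟨Mth, hM⟩ := h
  refine ⟨Mth, fun Mc hMc j c c₀ c₁ B₃ B₃' a₀ a₁ hG h₁ h₂ h₃ h₄ h₅ h₆ h₇ hT8 hT9 hTE hP9 hP9L => ?_⟩
  obtain ⟨γ₀, ε₂₉, E₂, κ, α₀, α₁, hγ, hε, hE, hκ, hα₀, hα₁, hD⟩ := hM Mc hMc j c c₀ c₁ B₃ B₃' a₀ a₁ hG h₁ h₂ h₃ h₄ h₅ h₆ h₇ hT8 hT9 hTE hP9 hP9L
  exact ⟨ε₂₉, hε, fun _ _ _ _ _ _ _ _ _ => ⟨γ₀, E₂, κ, α₀, α₁, hγ, hE, hκ, hα₀, hα₁, fun k _ v hv => hD k v hv⟩⟩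

/-- **v3.5's `stub_FE` statement implies v3.6's `stub_FEstep` statement.** [cite: Balaban1987RG1, Thm 3 p.264 (bookkeeping)] -/
theorem stubFEstep_of_stubFE (h : ∀ F, PortRecordFEHalfBox F) : ∀ F, FEStepBox F :=
  fun F => feStepBox_of_feHalfBox (h F)

/-- ★ **EQUIVALENCE MODULO THE LZ HALF**: given the LZ half for every torus family, the box text of the FE half and the inductive-step letter are equivalent (⟸ is ✓`portRecordFEHalfBox_of_lzHalf_step`,
the strong induction on the scale).  The v3.6 re-point is a re-shaping of the same wall, in kernel. [cite: Balaban1987RG1, Thm 3 p.264, p.268 L27–31] -/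
theorem feHalfBox_iff_feStepBox_of_lzHalf (hLZ : ∀ F, PortRecordLZHalf F) : (∀ F, PortRecordFEHalfBox F) ↔ (∀ F, FEStepBox F) :=
  ⟨stubFEstep_of_stubFE, portRecordFEHalfBox_of_lzHalf_step hLZ⟩

-- standard axioms only
#print axioms feHalfBox_iff_feStepBox_of_lzHalf

end Summit.QuantumFields.YangMills.Theorems.BalabanUVNodesPortS1

end
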